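import Mathlib
import HarnessLib
import Summits.NavierStokesRegularity.NavierStokesRegularity.Theorems.TypeIQuarterGateScarEnvelopeTypeIForcedTsaiAlgCertX
import Summits.NavierStokesRegularity.NavierStokesRegularity.Theorems.TypeIQuarterGateScarEnvelopeTypeIForcedTsaiAlgMomentsOdd

/-!
# ARM B lane E-exact, Type-I-tail class — MOMENT LEMMAS IV: EXACT moments over the BALL `B₁₀`
  (`∫_{B₁₀} c·y^a t^k v^h dy = π·⟨momentBallQ⟩`) behind `Poly5.integrateBall` (LANEX-ALG v4, `…ForcedTsaiAlgCertX`)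

* `Q4.eval` — the real value `q₀ + q₁·arctan x + q₂·√(1+x²) + q₃·arsinh x` of a coefficient vector;
* `Ireal x m h = ∫₀^x w^m (1+w²)^{−h/2} dw`, its base cases (`h = 0`; `I(0,1) = arsinh`, `I(0,2) = arctan`) and the two
  FTC recurrences (`Ireal_rec_m`, `Ireal_rec_h`); hence `Ireal_eq_levI : Ireal x (2k) h = ⟨levI x (2k) h⟩` for rational `x`;
* `integral_ball_polar3` — the ball version of the polar factorisation; `integral_ball_mono5` —
  `IntegrableOn (Mono5.eval τ m) B₁₀ ∧ ∫_{B₁₀} Mono5.eval τ m = π·⟨momentBallQ τ m⟩`; `integral_ball_poly5` (lists).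
Nothing here bears on NS regularity. [folklore: incomplete Beta integrals by parts]
-/

noncomputable section

set_option linter.dupNamespace false

namespace Summit.NavierStokesRegularity.NavierStokesRegularity.Cruxes.ScarEnvelopeTypeI.ForcedTsai

open MeasureTheory Set Metric Real Finset intervalIntegral
open scoped RealInnerProductSpace

/-! ## Real values of `Q4` -/

namespace Q4

/-- The real value `q₀ + q₁·arctan x + q₂·√(1+x²) + q₃·arsinh x`. -/
def eval (x : ℝ) (q : Q4) : ℝ :=
  (q.c0 : ℝ) + (q.c1 : ℝ) * Real.arctan x + (q.c2 : ℝ) * Real.sqrt (1 + x ^ 2) + (q.c3 : ℝ) * Real.arsinh x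

/-- Value of zero. -/
@[simp] theorem eval_zero (x : ℝ) : eval x Q4.zero = 0 := by simp [eval, Q4.zero]

/-- Value of a sum. -/
@[simp] theorem eval_add (x : ℝ) (p q : Q4) : eval x (Q4.add p q) = eval x p + eval x q := by
  simp only [eval, Q4.add]; push_cast; ring

/-- Value of a rational multiple. -/
@[simp] theorem eval_smul (x : ℝ) (c : ℚ) (p : Q4) : eval x (Q4.smul c p) = (c : ℝ) * eval x p := by
  simp only [eval, Q4.smul]; push_cast; ring

/-- Value of an explicit vector. -/
@[simp] theorem eval_mk (x : ℝ) (a b c d : ℚ) :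
    eval x ⟨a, b, c, d⟩ = (a : ℝ) + (b : ℝ) * Real.arctan x + (c : ℝ) * Real.sqrt (1 + x ^ 2) + (d : ℝ) * Real.arsinh x := rfl

end Q4

/-! ## The incomplete Beta integrals -/

/-- `I(m,h) = ∫₀^x w^m (1+w²)^{−h/2} dw`. -/
def Ireal (x : ℝ) (m h : ℕ) : ℝ := ∫ w in (0 : ℝ)..x, w ^ m * (1 + w ^ 2) ^ (-(h : ℝ) / 2)

/-- The integrand is continuous. -/
theorem continuous_Iintegrand (m : ℕ) (c : ℝ) : Continuous fun w : ℝ => w ^ m * (1 + w ^ 2) ^ c :=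
  (continuous_pow m).mul ((continuous_const.add (continuous_pow 2)).rpow_const fun w => Or.inl (show (0 : ℝ) < 1 + w ^ 2 by positivity).ne')

/-- Base case `h = 0`: `I(m,0) = x^{m+1}/(m+1)`. -/
theorem Ireal_zero (x : ℝ) (m : ℕ) : Ireal x m 0 = x ^ (m + 1) / ((m : ℝ) + 1) := by
  unfold Ireal
  have : (fun w : ℝ => w ^ m * (1 + w ^ 2) ^ (-((0 : ℕ) : ℝ) / 2)) = fun w => w ^ m := by
    funext w; simp
  rw [this, integral_pow]; simp

/-- Base case `I(0,2) = arctan x`. -/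
theorem Ireal_zero_two (x : ℝ) : Ireal x 0 2 = Real.arctan x := by
  unfold Ireal
  have : (fun w : ℝ => w ^ 0 * (1 + w ^ 2) ^ (-((2 : ℕ) : ℝ) / 2)) = fun w => (1 + w ^ 2)⁻¹ := by
    funext w
    rw [pow_zero, one_mul, show (-((2 : ℕ) : ℝ) / 2) = -1 by norm_num, Real.rpow_neg_one]
  rw [this, integral_inv_one_add_sq, Real.arctan_zero, sub_zero]

/-- Base case `I(0,1) = arsinh x`. -/
theorem Ireal_zero_one (x : ℝ) : Ireal x 0 1 = Real.arsinh x := by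
  unfold Ireal
  have hfun : (fun w : ℝ => w ^ 0 * (1 + w ^ 2) ^ (-((1 : ℕ) : ℝ) / 2)) = fun w => (Real.sqrt (1 + w ^ 2))⁻¹ := by
    funext w
    rw [pow_zero, one_mul, show (-((1 : ℕ) : ℝ) / 2) = -(1 / 2 : ℝ) by norm_num, Real.rpow_neg (show (0 : ℝ) < 1 + w ^ 2 by positivity).le,
      ← Real.sqrt_eq_rpow]
  have hint : IntervalIntegrable (fun w : ℝ => (Real.sqrt (1 + w ^ 2))⁻¹) volume 0 x :=
    ((Real.continuous_sqrt.comp (continuous_const.add (continuous_pow 2))).inv₀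
      fun w => (Real.sqrt_pos.2 (show (0 : ℝ) < 1 + w ^ 2 by positivity)).ne').intervalIntegrable _ _
  rw [hfun, integral_eq_sub_of_hasDerivAt (f := Real.arsinh) (fun w _ => Real.hasDerivAt_arsinh w) hint,
    Real.arsinh_zero, sub_zero]

/-- **Recurrence in `m`** (FTC for `w^{m+1}(1+w²)^{1−h/2}`):
`(m+1)·I(m,h) + (m+3−h)·I(m+2,h) = x^{m+1}(1+x²)^{1−h/2}`. -/
theorem Ireal_rec_m (x : ℝ) (m h : ℕ) :
    ((m : ℝ) + 1) * Ireal x m h + ((m : ℝ) + 3 - h) * Ireal x (m + 2) h =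
      x ^ (m + 1) * (1 + x ^ 2) ^ (1 - (h : ℝ) / 2) := by
  set c : ℝ := -(h : ℝ) / 2 with hc
  have hF : ∀ w : ℝ, HasDerivAt (fun w : ℝ => w ^ (m + 1) * (1 + w ^ 2) ^ (c + 1))
      (((m : ℝ) + 1) * (w ^ m * (1 + w ^ 2) ^ c) + ((m : ℝ) + 3 - h) * (w ^ (m + 2) * (1 + w ^ 2) ^ c)) w := by
    intro w
    have h1 : HasDerivAt (fun w : ℝ => w ^ (m + 1)) (((m + 1 : ℕ) : ℝ) * w ^ m) w := by
      simpa using hasDerivAt_pow (m + 1) w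
    have h2 : HasDerivAt (fun w : ℝ => 1 + w ^ 2) (2 * w) w := by
      simpa using (hasDerivAt_pow 2 w).const_add 1
    have h3 : HasDerivAt (fun w : ℝ => (1 + w ^ 2) ^ (c + 1)) (2 * w * (c + 1) * (1 + w ^ 2) ^ (c + 1 - 1)) w :=
      h2.rpow_const (Or.inl (show (0 : ℝ) < 1 + w ^ 2 by positivity).ne')
    have h4 : HasDerivAt (fun w : ℝ => w ^ (m + 1) * (1 + w ^ 2) ^ (c + 1))
        (((m + 1 : ℕ) : ℝ) * w ^ m * (1 + w ^ 2) ^ (c + 1) + w ^ (m + 1) * (2 * w * (c + 1) * (1 + w ^ 2) ^ (c + 1 - 1))) w :=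
      h1.mul h3
    refine h4.congr_deriv ?_
    have hK : (1 + w ^ 2) ^ (c + 1) = (1 + w ^ 2) ^ c * (1 + w ^ 2) := Real.rpow_add_one (show (0 : ℝ) < 1 + w ^ 2 by positivity).ne' c
    rw [show c + 1 - 1 = c by ring, hK, hc]; push_cast; ring
  have hi1 : IntervalIntegrable (fun w : ℝ => ((m : ℝ) + 1) * (w ^ m * (1 + w ^ 2) ^ c)) volume 0 x :=
    (continuous_const.mul (continuous_Iintegrand m c)).intervalIntegrable _ _
  have hi2 : IntervalIntegrable (fun w : ℝ => ((m : ℝ) + 3 - h) * (w ^ (m + 2) * (1 + w ^ 2) ^ c)) volume 0 x :=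
    (continuous_const.mul (continuous_Iintegrand (m + 2) c)).intervalIntegrable _ _
  have key := integral_eq_sub_of_hasDerivAt (fun w _ => hF w) (hi1.add hi2)
  rw [intervalIntegral.integral_add hi1 hi2, intervalIntegral.integral_const_mul, intervalIntegral.integral_const_mul,
    zero_pow (Nat.succ_ne_zero m), zero_mul, sub_zero] at key
  unfold Ireal
  rw [← hc, show (1 : ℝ) - (h : ℝ) / 2 = c + 1 by rw [hc]; ring]
  linear_combination key

/-- **Recurrence in `h`** (FTC for `w^{m+1}(1+w²)^{−h/2}`):
`h·I(m,h+2) = (h−m−1)·I(m,h) + x^{m+1}(1+x²)^{−h/2}`. -/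
theorem Ireal_rec_h (x : ℝ) (m h : ℕ) :
    (h : ℝ) * Ireal x m (h + 2) = ((h : ℝ) - m - 1) * Ireal x m h + x ^ (m + 1) * (1 + x ^ 2) ^ (-(h : ℝ) / 2) := by
  set c : ℝ := -(h : ℝ) / 2 with hc
  have hc2 : -(((h + 2 : ℕ) : ℝ)) / 2 = c - 1 := by rw [hc]; push_cast; ring
  have hF : ∀ w : ℝ, HasDerivAt (fun w : ℝ => w ^ (m + 1) * (1 + w ^ 2) ^ c)
      (((m : ℝ) + 1 - h) * (w ^ m * (1 + w ^ 2) ^ c) + (h : ℝ) * (w ^ m * (1 + w ^ 2) ^ (c - 1))) w := by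
    intro w
    have h1 : HasDerivAt (fun w : ℝ => w ^ (m + 1)) (((m + 1 : ℕ) : ℝ) * w ^ m) w := by
      simpa using hasDerivAt_pow (m + 1) w
    have h2 : HasDerivAt (fun w : ℝ => 1 + w ^ 2) (2 * w) w := by
      simpa using (hasDerivAt_pow 2 w).const_add 1
    have h3 : HasDerivAt (fun w : ℝ => (1 + w ^ 2) ^ c) (2 * w * c * (1 + w ^ 2) ^ (c - 1)) w :=
      h2.rpow_const (Or.inl (show (0 : ℝ) < 1 + w ^ 2 by positivity).ne')
    have h4 : HasDerivAt (fun w : ℝ => w ^ (m + 1) * (1 + w ^ 2) ^ c)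
        (((m + 1 : ℕ) : ℝ) * w ^ m * (1 + w ^ 2) ^ c + w ^ (m + 1) * (2 * w * c * (1 + w ^ 2) ^ (c - 1))) w :=
      h1.mul h3
    refine h4.congr_deriv ?_
    -- w^{m+2} K^{c-1} = w^m K^c − w^m K^{c−1}
    have hK : (1 + w ^ 2) ^ c = (1 + w ^ 2) ^ (c - 1) * (1 + w ^ 2) := by
      rw [← Real.rpow_add_one (show (0 : ℝ) < 1 + w ^ 2 by positivity).ne', sub_add_cancel]
    rw [hK, hc]; push_cast; ring
  have hi1 : IntervalIntegrable (fun w : ℝ => ((m : ℝ) + 1 - h) * (w ^ m * (1 + w ^ 2) ^ c)) volume 0 x :=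
    (continuous_const.mul (continuous_Iintegrand m c)).intervalIntegrable _ _
  have hi2 : IntervalIntegrable (fun w : ℝ => (h : ℝ) * (w ^ m * (1 + w ^ 2) ^ (c - 1))) volume 0 x :=
    (continuous_const.mul (continuous_Iintegrand m (c - 1))).intervalIntegrable _ _
  have key := integral_eq_sub_of_hasDerivAt (fun w _ => hF w) (hi1.add hi2)
  rw [intervalIntegral.integral_add hi1 hi2, intervalIntegral.integral_const_mul, intervalIntegral.integral_const_mul,
    zero_pow (Nat.succ_ne_zero m), zero_mul, sub_zero] at key
  unfold Ireal
  rw [hc2, ← hc]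
  linear_combination key

/-! ## `Ireal = ⟨levI⟩` for even `m` and rational `x` -/

/-- `levC` evaluates to `x^{m+1}(1+x²)^{−h/2}`. -/
theorem eval_levC (xq : ℚ) (m h : ℕ) :
    Q4.eval (xq : ℝ) (levC xq m h) = (xq : ℝ) ^ (m + 1) * (1 + (xq : ℝ) ^ 2) ^ (-(h : ℝ) / 2) := by
  have hK : (0 : ℝ) < 1 + (xq : ℝ) ^ 2 := by positivity
  unfold levC
  by_cases hpar : h % 2 = 0
  · rw [if_pos hpar, Q4.eval_mk]
    obtain ⟨n, hn⟩ : ∃ n, h = 2 * n := ⟨h / 2, by omega⟩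
    have hdiv : h / 2 = n := by omega
    rw [hdiv, hn, show (-((2 * n : ℕ) : ℝ) / 2) = -(n : ℝ) by push_cast; ring, Real.rpow_neg hK.le, Real.rpow_natCast]
    push_cast; ring
  · rw [if_neg hpar, Q4.eval_mk]
    obtain ⟨n, hn⟩ : ∃ n, h = 2 * n + 1 := ⟨h / 2, by omega⟩
    have hdiv : (h + 1) / 2 = n + 1 := by omega
    rw [hdiv, hn]
    have hsqrt : Real.sqrt (1 + (xq : ℝ) ^ 2) = (1 + (xq : ℝ) ^ 2) ^ (1 / 2 : ℝ) := Real.sqrt_eq_rpow _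
    have hsplit : (1 + (xq : ℝ) ^ 2) ^ (-((2 * n + 1 : ℕ) : ℝ) / 2) =
        (1 + (xq : ℝ) ^ 2) ^ (1 / 2 : ℝ) * ((1 + (xq : ℝ) ^ 2) ^ (n + 1))⁻¹ := by
      rw [← Real.rpow_natCast _ (n + 1), ← Real.rpow_neg hK.le, ← Real.rpow_add hK]
      congr 1; push_cast; ring
    rw [hsplit, hsqrt]; push_cast; ring

/-- `I(2k, 1) = ⟨levI1 x (2k)⟩`. -/
theorem Ireal_one_eq (xq : ℚ) (k : ℕ) : Ireal (xq : ℝ) (2 * k) 1 = Q4.eval (xq : ℝ) (levI1 xq (2 * k)) := by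
  induction k with
  | zero => simp [levI1, Ireal_zero_one]
  | succ k ih =>
    rw [show 2 * (k + 1) = 2 * k + 2 by ring, levI1, Q4.eval_smul, Q4.eval_add, Q4.eval_smul, ← ih, Q4.eval_mk]
    have hrec := Ireal_rec_m (xq : ℝ) (2 * k) 1
    rw [show (1 : ℝ) - ((1 : ℕ) : ℝ) / 2 = 1 / 2 by norm_num, ← Real.sqrt_eq_rpow] at hrec
    have hk : (0 : ℝ) ≤ k := k.cast_nonneg
    have hne : ((2 * k : ℕ) : ℝ) + 3 - ((1 : ℕ) : ℝ) ≠ 0 := by apply ne_of_gt; push_cast; linarith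
    have hval : Ireal (xq : ℝ) (2 * k + 2) 1 =
        ((xq : ℝ) ^ (2 * k + 1) * Real.sqrt (1 + (xq : ℝ) ^ 2) - (((2 * k : ℕ) : ℝ) + 1) * Ireal (xq : ℝ) (2 * k) 1) /
          (((2 * k : ℕ) : ℝ) + 3 - ((1 : ℕ) : ℝ)) := by
      rw [eq_div_iff hne]; linear_combination hrec
    rw [hval]; push_cast
    have : (2 * (k : ℝ) + 3 - 1) ≠ 0 := by apply ne_of_gt; linarith
    have : (2 * (k : ℝ) + 2) ≠ 0 := by apply ne_of_gt; linarith
    field_simp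
    ring

/-- `I(2k, 2) = ⟨levI2 x (2k)⟩`. -/
theorem Ireal_two_eq (xq : ℚ) (k : ℕ) : Ireal (xq : ℝ) (2 * k) 2 = Q4.eval (xq : ℝ) (levI2 xq (2 * k)) := by
  induction k with
  | zero => simp [levI2, Ireal_zero_two]
  | succ k ih =>
    rw [show 2 * (k + 1) = 2 * k + 2 by ring, levI2, Q4.eval_smul, Q4.eval_add, Q4.eval_smul, ← ih, Q4.eval_mk]
    have hrec := Ireal_rec_m (xq : ℝ) (2 * k) 2
    rw [show (1 : ℝ) - ((2 : ℕ) : ℝ) / 2 = 0 by norm_num, Real.rpow_zero, mul_one] at hrec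
    have hk : (0 : ℝ) ≤ k := k.cast_nonneg
    have hne : ((2 * k : ℕ) : ℝ) + 3 - ((2 : ℕ) : ℝ) ≠ 0 := by apply ne_of_gt; push_cast; linarith
    have hval : Ireal (xq : ℝ) (2 * k + 2) 2 =
        ((xq : ℝ) ^ (2 * k + 1) - (((2 * k : ℕ) : ℝ) + 1) * Ireal (xq : ℝ) (2 * k) 2) /
          (((2 * k : ℕ) : ℝ) + 3 - ((2 : ℕ) : ℝ)) := by
      rw [eq_div_iff hne]; linear_combination hrec
    rw [hval]; push_cast
    have : (2 * (k : ℝ) + 3 - 2) ≠ 0 := by apply ne_of_gt; linarith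
    have : (2 * (k : ℝ) + 1) ≠ 0 := by apply ne_of_gt; linarith
    field_simp
    ring

/-- **`I(m,h) = ⟨levI x m h⟩`** for even `m = 2k`, all `h`, rational `x`. -/
theorem Ireal_eq_levI (xq : ℚ) (k : ℕ) : ∀ h : ℕ, Ireal (xq : ℝ) (2 * k) h = Q4.eval (xq : ℝ) (levI xq (2 * k) h) := by
  intro h
  induction h using Nat.twoStepInduction with
  | zero => rw [levI, Ireal_zero, Q4.eval_mk]; push_cast; ring
  | one => rw [levI]; exact Ireal_one_eq xq k
  | more n ih0 _ =>
    rcases n with _ | n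
    · rw [levI]; exact Ireal_two_eq xq k
    · -- I(m, n+3) from I(m, n+1)
      rw [show n + 1 + 2 = n + 3 by ring, levI, Q4.eval_smul, Q4.eval_add, Q4.eval_smul, ← ih0, eval_levC]
      have hrec := Ireal_rec_h (xq : ℝ) (2 * k) (n + 1)
      have hne : (((n + 1 : ℕ) : ℝ)) ≠ 0 := by positivity
      rw [show n + 1 + 2 = n + 3 by ring] at hrec
      have hval : Ireal (xq : ℝ) (2 * k) (n + 3) =
          (((((n + 1 : ℕ) : ℝ)) - ((2 * k : ℕ) : ℝ) - 1) * Ireal (xq : ℝ) (2 * k) (n + 1) +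
            (xq : ℝ) ^ (2 * k + 1) * (1 + (xq : ℝ) ^ 2) ^ (-(((n + 1 : ℕ) : ℝ)) / 2)) / (((n + 1 : ℕ) : ℝ)) := by
        rw [eq_div_iff hne]; linear_combination hrec
      rw [hval]; push_cast
      have : ((n : ℝ) + 1) ≠ 0 := by positivity
      field_simp

/-! ## Ball moments -/

/-- **Polar factorisation on a ball**: `∫_{B_R} Θ(y/|y|)·R(|y|) dy = (∫_{S²} Θ dσ)·∫₀^R r² R(r) dr` (`R > 0`). -/
theorem integral_ball_polar3 (Θ : E3 → ℝ) (R : ℝ → ℝ) {ρ : ℝ} (hρ : 0 < ρ) :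
    ∫ y in ball (0 : E3) ρ, Θ (‖y‖⁻¹ • y) * R ‖y‖ =
      (∫ θ : sphere (0 : E3) 1, Θ θ ∂((volume : Measure E3).toSphere)) * ∫ r in (0 : ℝ)..ρ, r ^ 2 * R r := by
  rw [← MeasureTheory.integral_indicator measurableSet_ball]
  have hfun : (ball (0 : E3) ρ).indicator (fun y => Θ (‖y‖⁻¹ • y) * R ‖y‖) =
      fun y => Θ (‖y‖⁻¹ • y) * ((Iio ρ).indicator R ‖y‖) := by
    funext y
    by_cases hy : y ∈ ball (0 : E3) ρ
    · have : ‖y‖ ∈ Iio ρ := by simpa [mem_ball, dist_zero_right] using hy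
      rw [indicator_of_mem hy, indicator_of_mem this]
    · have : ‖y‖ ∉ Iio ρ := by simpa [mem_ball, dist_zero_right] using hy
      rw [indicator_of_notMem hy, indicator_of_notMem this, mul_zero]
  rw [hfun, integral_polar3]
  congr 1
  have h2 : (fun r : ℝ => r ^ 2 * (Iio ρ).indicator R r) = (Iio ρ).indicator (fun r => r ^ 2 * R r) := by
    funext r; by_cases hr : r ∈ Iio ρ
    · rw [indicator_of_mem hr, indicator_of_mem hr]
    · rw [indicator_of_notMem hr, indicator_of_notMem hr, mul_zero]
  have hI : Ioi (0 : ℝ) ∩ Iio ρ = Ioo 0 ρ := by ext; simp [Set.mem_Ioo]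
  rw [h2, setIntegral_indicator measurableSet_Iio, hI, intervalIntegral.integral_of_le hρ.le, integral_Ioc_eq_integral_Ioo]

/-- The radial profile of `y^a t^k v^h` (coefficient-free): `r ↦ r^{|a|+2k}(1+r²/τ²)^{−h/2}`. -/
def radE (τ : ℝ) (m : Mono5) (r : ℝ) : ℝ :=
  r ^ (m.e1 + m.e2 + m.e3 + 2 * m.et) * (1 + r ^ 2 / τ ^ 2) ^ (-(m.eh : ℝ) / 2)

/-- **Polar form of `Mono5.eval`**: direction monomial × (coefficient · radial profile at `|y|`). -/
theorem eval_eq_polar (τ : ℝ) (m : Mono5) (y : E3) :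
    Mono5.eval τ m y = (∏ j : Fin 3, ((‖y‖⁻¹ • y) j) ^ m.yMono.exp j) * ((m.c : ℝ) * radE τ m ‖y‖) := by
  have hprod : (m.c : ℝ) * y 0 ^ m.e1 * y 1 ^ m.e2 * y 2 ^ m.e3 = Mono.eval m.yMono y := rfl
  rw [Mono5.eval, hprod, Mono.eval_eq_prod, ← dir_prod_pow_mul y m.yMono, vpow, kbase, radE]
  simp only [Mono5.yMono]
  ring

/-- **Radial substitution**: `∫₀^{10} r² · r^{n} (1+r²/τ²)^{−h/2} dr = τ^{n+3} · I(n+2, h)` at `x = 10/τ` (`τ > 0`). -/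
theorem integral_radE_eq (τ : ℝ) (hτ : 0 < τ) (n h : ℕ) :
    ∫ r in (0 : ℝ)..10, r ^ 2 * (r ^ n * (1 + r ^ 2 / τ ^ 2) ^ (-(h : ℝ) / 2)) =
      τ ^ (n + 3) * Ireal (10 / τ) (n + 2) h := by
  have hτ0 : τ ≠ 0 := hτ.ne'
  set F : ℝ → ℝ := fun w => τ ^ (n + 2) * (w ^ (n + 2) * (1 + w ^ 2) ^ (-(h : ℝ) / 2)) with hF
  have hfun : (fun r : ℝ => r ^ 2 * (r ^ n * (1 + r ^ 2 / τ ^ 2) ^ (-(h : ℝ) / 2))) = fun r => F (r / τ) := by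
    funext r
    simp only [hF, div_pow]
    field_simp
    ring
  rw [hfun, intervalIntegral.integral_comp_div F hτ0, zero_div, Ireal]
  simp only [hF]
  rw [intervalIntegral.integral_const_mul, smul_eq_mul]
  ring

/-- **Exact ball moment of a 5-monomial**: `Mono5.eval τ m` is integrable on `B₁₀` and
`∫_{B₁₀} c y^a t^k v^h dy = π·⟨momentBallQ τ m⟩` (rational `τ > 0`; every `(a,k,h)`). -/
theorem integral_ball_mono5 {τq : ℚ} (hτq : 0 < τq) (m : Mono5) :
    IntegrableOn (fun y : E3 => Mono5.eval (τq : ℝ) m y) (ball (0 : E3) 10) ∧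
      ∫ y in ball (0 : E3) 10, Mono5.eval (τq : ℝ) m y = π * Q4.eval ((10 / τq : ℚ) : ℝ) (m.momentBallQ τq) := by
  set τ : ℝ := (τq : ℝ) with hτdef
  have hτ : 0 < τ := by rw [hτdef]; exact_mod_cast hτq
  constructor
  · exact ((Mono5.continuous_eval τ m).continuousOn.integrableOn_compact (isCompact_closedBall (0 : E3) 10)).mono_set
      ball_subset_closedBall
  · have hfun : (fun y : E3 => Mono5.eval τ m y) =
        fun y => (∏ j : Fin 3, ((‖y‖⁻¹ • y) j) ^ m.yMono.exp j) * ((m.c : ℝ) * radE τ m ‖y‖) :=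
      funext (eval_eq_polar τ m)
    rw [hfun, integral_ball_polar3 (fun θ : E3 => ∏ j : Fin 3, (θ j) ^ m.yMono.exp j)
      (fun r : ℝ => (m.c : ℝ) * radE τ m r) (by norm_num : (0 : ℝ) < 10)]
    have hrad : ∫ r in (0 : ℝ)..10, r ^ 2 * ((m.c : ℝ) * radE τ m r) =
        (m.c : ℝ) * (τ ^ (m.e1 + m.e2 + m.e3 + 2 * m.et + 3) * Ireal (10 / τ) (m.e1 + m.e2 + m.e3 + 2 * m.et + 2) m.eh) := by
      rw [← integral_radE_eq τ hτ, ← intervalIntegral.integral_const_mul]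
      congr 1; funext r; simp only [radE]; ring
    rw [show (∫ θ : sphere (0 : E3) 1, (fun θ : E3 => ∏ j : Fin 3, (θ j) ^ m.yMono.exp j) θ
      ∂((volume : Measure E3).toSphere)) = sphMono m.yMono from rfl, sphMono_eq, hrad]
    simp only [Mono5.yMono]
    unfold Mono5.momentBallQ
    by_cases he : m.e1 % 2 = 1 ∨ m.e2 % 2 = 1 ∨ m.e3 % 2 = 1
    · rw [if_pos he, if_pos he]; simp
    · rw [if_neg he, if_neg he, Q4.eval_smul]
      obtain ⟨k, hk⟩ : ∃ k, m.e1 + m.e2 + m.e3 + 2 * m.et + 2 = 2 * k := ⟨(m.e1 + m.e2 + m.e3) / 2 + m.et + 1, by omega⟩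
      have hx : ((10 / τq : ℚ) : ℝ) = 10 / τ := by rw [hτdef]; push_cast; ring
      rw [hk, ← hx, ← Ireal_eq_levI (10 / τq) k]
      push_cast
      rw [← hτdef]
      ring

/-! ## Lists: `Poly5.integrateBall` -/

/-- The `Q4` fold of `integrateBall`, generalised accumulator. -/
theorem eval_foldl_integrateBall (x : ℝ) (τ : ℚ) (E : Poly5) (acc : Q4) :
    Q4.eval x (E.foldl (fun acc m => Q4.add acc (Mono5.momentBallQ τ m)) acc) =
      Q4.eval x acc + (E.map fun m => Q4.eval x (Mono5.momentBallQ τ m)).sum := by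
  induction E generalizing acc with
  | nil => simp
  | cons m E ih => rw [List.foldl_cons, ih, List.map_cons, List.sum_cons, Q4.eval_add]; ring

/-- **`Poly5.integrateBall` is sound**: `Poly5.eval τ P` is integrable on `B₁₀` and
`∫_{B₁₀} Poly5.eval τ P = π·⟨integrateBall τ P⟩` (rational `τ > 0`). -/
theorem integral_ball_poly5 {τq : ℚ} (hτq : 0 < τq) (P : Poly5) :
    IntegrableOn (fun y : E3 => Poly5.eval (τq : ℝ) P y) (ball (0 : E3) 10) ∧
      ∫ y in ball (0 : E3) 10, Poly5.eval (τq : ℝ) P y = π * Q4.eval ((10 / τq : ℚ) : ℝ) (Poly5.integrateBall τq P) := by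
  unfold Poly5.integrateBall
  rw [eval_foldl_integrateBall, Q4.eval_zero, zero_add]
  induction P with
  | nil => simp
  | cons m P ih =>
    obtain ⟨hmi, hmv⟩ := integral_ball_mono5 hτq m
    obtain ⟨hPi, hPv⟩ := ih
    have hsplit : (fun y : E3 => Poly5.eval (τq : ℝ) (m :: P) y) =
        fun y => Mono5.eval (τq : ℝ) m y + Poly5.eval (τq : ℝ) P y := by funext y; rw [Poly5.eval_cons]
    rw [hsplit]
    refine ⟨hmi.add hPi, ?_⟩
    rw [integral_add hmi hPi, hmv, hPv, List.map_cons, List.sum_cons]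
    ring

end Summit.NavierStokesRegularity.NavierStokesRegularity.Cruxes.ScarEnvelopeTypeI.ForcedTsai

end
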